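import Literature.Probability.Process.RenewalRatioSandwich
import Mathlib.Analysis.SpecialFunctions.Pow.Real
import Mathlib.Analysis.SpecialFunctions.Pow.Asymptotics
import Mathlib.Analysis.SpecialFunctions.Log.Basic
import HarnessLib

/-!
# The one-step ratio rate `|w_{N+1}/w_N − β| ≤ K/log N` from a renewal inequality, Kesten's tail and a
# two-step upper rate (model-free form of Madras–Slade Theorem 7.3.4 (d) with a rate)

Topic `Literature/Probability/Process` (continues `RenewalRatioSandwich.lean`: `Renewal.ratio_sandwich_sharp_of_le`).
This file is the MODEL-FREE re-typing of the tree's `ℤ^d` engine `SAW.Zd.ratio_rate_eventually_of` /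
`ratio_rate_log_of` (`Literature/Probability/RandomPlanarGeometry/SAWRenewalRatioRate.lean`): there the masses are
Kesten's `p_k = λ_k μ^{-k}` of `ℤ^{d+2}` and the tail bound is the tree theorem `Zd.kestenTail_le_inv_log`; here the
data are an abstract positive sequence `w`, abstract masses `lam k / β^k` and six hypotheses, so that the same 300
lines serve the bridges and the half-space walks of the hexagonal lattice in the brick-wall frame (lane «pcv-sawmu»,
route R86) and any future count class.

Sources: N. Madras, G. Slade, *The Self-Avoiding Walk* (1993), Theorem 7.3.4 (d) and its proof via (7.3.14)
(pp. 248–249) — a limit with no rate; G. F. Lawler, O. Schramm, W. Werner (2004), Appendix A (A.3) — the same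
renewal-inequality argument for half-space walks, no rate [cite: LawlerSchrammWerner2004SAW].  No rate is printed
for any lattice; the shape `K/log N` with `T = ⌊N^{1/8}⌋` is the tree's own bookkeeping of the (7.3.14) argument.

## Hypotheses and statement (namespace `Literature.Probability.Process.Renewal.LogRate`)

For `β ≥ 1`, `w > 0`, masses `lam ≥ 0` with `lam 1 ≥ 1`, all partial sums `Σ_{k∈s} lam k/β^k ≤ 1`, the TAIL bound
`1 − Σ_{k≤m} lam k/β^k ≤ 1/(1 + ½ log(m/β))` (`m ≥ max(1, β)`), the renewal INEQUALITY
`Σ_{1≤k≤n} lam k · w_{n−k} ≤ w_n` and an upper two-step rate `w_{N+2}/w_N ≤ β²(1 + K′N^{-1/4})` (`N ≥ N₀`):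
* `ratio_rate_eventually_of` — `|w_n/w_{n−1} − β| ≤ β(128β + 64βK′ + 64K′)/log n` eventually;
* **`ratio_rate_log_of`** — `∃ K, ∀ N ≥ 2, |w_{N+1}/w_N − β| ≤ K/log N`.
-/

noncomputable section

open Finset Filter Topology
open scoped BigOperators

namespace Literature.Probability.Process.Renewal.LogRate

variable {β : ℝ} {lam : ℕ → ℝ}

/-- The masses `p_k = lam k / β^k`. [cite: MadrasSlade1993, §4.2, eq. (4.2.5) (p. 91)] -/
def mass (lam : ℕ → ℝ) (β : ℝ) (k : ℕ) : ℝ := lam k / β ^ k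

/-- The normalised sequence `a_n = w_n β^{-n}`. [cite: MadrasSlade1993, §4.2, eq. (4.2.5) (p. 91)] -/
def normSeq (β : ℝ) (w : ℕ → ℝ) (n : ℕ) : ℝ := w n / β ^ n

/-- `a_n > 0` for a positive sequence. [cite: MadrasSlade1993, §4.2 (p. 91)] -/
theorem normSeq_pos (hβ0 : 0 < β) {w : ℕ → ℝ} (hw : ∀ n, 0 < w n) (n : ℕ) : 0 < normSeq β w n := by
  have := hw n
  unfold normSeq; positivity

/-- The renewal INEQUALITY in normalised form: `Σ_{1≤k≤n} p_k a_{n−k} ≤ a_n`.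
[cite: MadrasSlade1993, §4.2, eq. (4.2.2)/(4.2.5) (p. 91); LawlerSchrammWerner2004SAW, Appendix (A.3)] -/
theorem normSeq_renewal_le (hβ0 : 0 < β) {w : ℕ → ℝ}
    (hren : ∀ n, 1 ≤ n → ∑ k ∈ Icc 1 n, lam k * w (n - k) ≤ w n) :
    ∀ n, 1 ≤ n → ∑ k ∈ Icc 1 n, mass lam β k * normSeq β w (n - k) ≤ normSeq β w n := by
  intro n hn
  have h := hren n hn
  unfold mass normSeq
  have e : ∑ k ∈ Icc 1 n, lam k / β ^ k * (w (n - k) / β ^ (n - k)) =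
      (∑ k ∈ Icc 1 n, lam k * w (n - k)) / β ^ n := by
    rw [Finset.sum_div]
    refine Finset.sum_congr rfl fun k hk => ?_
    have hkn : k ≤ n := (Finset.mem_Icc.1 hk).2
    rw [div_mul_div_comm, ← pow_add, Nat.add_sub_cancel' hkn]
  rw [e]
  exact div_le_div_of_nonneg_right h (pow_pos hβ0 n).le

/-- The packaged factor-4 sandwich under a renewal inequality (from `Renewal.ratio_sandwich_sharp_of_le`). [folklore] -/
private theorem sandwich_packaged_of_le (a p : ℕ → ℝ) (N T : ℕ) (η : ℝ) (hT1 : 1 ≤ T) (hT : 2 * T + 1 ≤ N)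
    (hη : 0 ≤ η) (hTη : (T : ℝ) * η ≤ 1 / 2)
    (ha0 : ∀ n, 0 ≤ a n) (hp0 : ∀ k, 0 ≤ p k) (haN : 0 < a N) (haN1 : 0 < a (N - 1)) (hp1 : 0 < p 1)
    (hsum : ∑ k ∈ Icc 1 (2 * T + 1), p k ≤ 1)
    (hren_le : ∀ n, 1 ≤ n → ∑ k ∈ Icc 1 n, p k * a (n - k) ≤ a n)
    (hup : ∀ M, N - (2 * T + 1) ≤ M → M + 2 ≤ N → a (M + 2) ≤ (1 + η) * a M) :
    |a N / a (N - 1) - 1| ≤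
      4 * (((1 - ∑ k ∈ Icc 1 (2 * T), p k) + T * η) / (∑ t ∈ range T, p (2 * t + 1)) + T * η) := by
  have h := _root_.Literature.Probability.Process.Renewal.ratio_sandwich_sharp_of_le a p N T η hT1 hT hη hTη
    ha0 hp0 haN haN1 hp1 hsum hren_le hup
  set ε := 1 - ∑ k ∈ Icc 1 (2 * T), p k with hε
  set Eo := ∑ t ∈ range T, p (2 * t + 1) with hEo
  have hEo_pos : 0 < Eo := by
    have : p (2 * 0 + 1) ≤ Eo :=
      Finset.single_le_sum (f := fun t => p (2 * t + 1)) (fun t _ => hp0 _)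
        (Finset.mem_range.2 (by omega))
    simp only [Nat.mul_zero, Nat.zero_add] at this
    linarith
  have hTη0 : 0 ≤ (T : ℝ) * η := mul_nonneg (Nat.cast_nonneg T) hη
  have hε0 : 0 ≤ ε := by
    have h1 := hsum
    rw [Finset.sum_Icc_succ_top (by omega)] at h1
    have := hp0 (2 * T + 1)
    rw [hε]; linarith
  have hθ : (1 : ℝ) / 2 ≤ 1 - T * η := by linarith
  have h2 : (ε + T * η) / ((1 - T * η) * Eo) ≤ 2 * ((ε + T * η) / Eo) := by
    rw [div_le_iff₀ (mul_pos (by linarith) hEo_pos)]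
    have e : 2 * ((ε + T * η) / Eo) * ((1 - T * η) * Eo) = 2 * (ε + T * η) * (1 - T * η) := by
      field_simp
    rw [e]; nlinarith
  have hb0 : 0 ≤ (ε + T * η) / Eo := div_nonneg (by linarith) hEo_pos.le
  exact h.trans (by linarith)

/-- The window control from the upper two-step rate: with `η = 2K n^{-1/4}`, for every `M`
in `[n − 2T − 1, n − 2]` (where `M ≥ n/2 ≥ N₀`), `a_{M+2} ≤ (1+η) a_M`.
[cite: MadrasSlade1993, Theorem 7.3.4 (d) (proof), eq. (7.3.13)] -/
theorem hup_of_upperRate (hβ0 : 0 < β) {w : ℕ → ℝ} (hw : ∀ n, 0 < w n) {K : ℝ} {N₀ : ℕ} (hK : 0 ≤ K) (hU : ∀ N : ℕ, N₀ ≤ N → w (N + 2) / w N ≤ β ^ 2 * (1 + K * (N : ℝ) ^ (-(1 : ℝ) / 4)))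
    {n T : ℕ} (hwin : 2 * (2 * T + 1) ≤ n) (hN₀ : 2 * N₀ ≤ n) :
    ∀ M, n - (2 * T + 1) ≤ M → M + 2 ≤ n →
      normSeq β w (M + 2) ≤ (1 + 2 * K * (n : ℝ) ^ (-(1 : ℝ) / 4)) * normSeq β w M := by
  intro M hM1 hM2
  have h2M : n ≤ 2 * M := by omega
  have hMN : N₀ ≤ M := by omega
  have hM0 : 1 ≤ M := by omega
  set μ := β with hμdef
  have hμ : 0 < μ := hβ0
  have hbM : (0 : ℝ) < w M := hw M
  -- `M^{-1/4} ≤ 2 n^{-1/4}`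
  have hn0 : (0 : ℝ) < n := by exact_mod_cast (show 0 < n by omega)
  have hMr : (n : ℝ) / 2 ≤ M := by
    have : (n : ℝ) ≤ 2 * M := by exact_mod_cast h2M
    linarith
  have hpow : (M : ℝ) ^ (-(1 : ℝ) / 4) ≤ 2 * (n : ℝ) ^ (-(1 : ℝ) / 4) := by
    have h1 : (M : ℝ) ^ (-(1 : ℝ) / 4) ≤ ((n : ℝ) / 2) ^ (-(1 : ℝ) / 4) :=
      Real.rpow_le_rpow_of_nonpos (by positivity) hMr (by norm_num)
    have h2 : ((n : ℝ) / 2) ^ (-(1 : ℝ) / 4) = (n : ℝ) ^ (-(1 : ℝ) / 4) / (2 : ℝ) ^ (-(1 : ℝ) / 4) :=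
      Real.div_rpow hn0.le (by norm_num) _
    have h3 : (1 / 2 : ℝ) ≤ (2 : ℝ) ^ (-(1 : ℝ) / 4) := by
      rw [show (-(1 : ℝ) / 4) = -((1 : ℝ) / 4) by ring, Real.rpow_neg (by norm_num), one_div]
      refine inv_anti₀ (by positivity) ?_
      calc (2 : ℝ) ^ ((1 : ℝ) / 4) ≤ (2 : ℝ) ^ (1 : ℝ) :=
            Real.rpow_le_rpow_of_exponent_le (by norm_num) (by norm_num)
        _ = 2 := Real.rpow_one 2
    have h4 : 0 ≤ (n : ℝ) ^ (-(1 : ℝ) / 4) := Real.rpow_nonneg hn0.le _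
    calc (M : ℝ) ^ (-(1 : ℝ) / 4) ≤ (n : ℝ) ^ (-(1 : ℝ) / 4) / (2 : ℝ) ^ (-(1 : ℝ) / 4) := by rw [← h2]; exact h1
      _ ≤ (n : ℝ) ^ (-(1 : ℝ) / 4) / (1 / 2) := div_le_div_of_nonneg_left h4 (by norm_num) h3
      _ = 2 * (n : ℝ) ^ (-(1 : ℝ) / 4) := by ring
  have hrat : w (M + 2) / w M ≤
      μ ^ 2 * (1 + 2 * K * (n : ℝ) ^ (-(1 : ℝ) / 4)) := by
    calc w (M + 2) / w M
        ≤ μ ^ 2 * (1 + K * (M : ℝ) ^ (-(1 : ℝ) / 4)) := hU M hMN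
      _ ≤ μ ^ 2 * (1 + K * (2 * (n : ℝ) ^ (-(1 : ℝ) / 4))) := by gcongr
      _ = μ ^ 2 * (1 + 2 * K * (n : ℝ) ^ (-(1 : ℝ) / 4)) := by ring
  have hb2 : w (M + 2) ≤
      μ ^ 2 * (1 + 2 * K * (n : ℝ) ^ (-(1 : ℝ) / 4)) * w M := by
    rwa [div_le_iff₀ hbM] at hrat
  unfold normSeq
  rw [div_le_iff₀ (pow_pos hμ _), pow_add, show (1 + 2 * K * (n : ℝ) ^ (-(1 : ℝ) / 4)) *
    (w M / μ ^ M) * (μ ^ M * μ ^ 2) =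
    μ ^ 2 * (1 + 2 * K * (n : ℝ) ^ (-(1 : ℝ) / 4)) * w M by
      field_simp]
  exact hb2

/-- Elementary: for `y ≥ 2`, `4y + 2 ≤ y^8`. [folklore] -/
private theorem four_mul_add_two_le_pow_eight {y : ℝ} (hy : 2 ≤ y) : 4 * y + 2 ≤ y ^ 8 := by
  have h7 : (2 : ℝ) ^ 7 ≤ y ^ 7 := pow_le_pow_left₀ (by norm_num) hy 7
  have hy0 : 0 ≤ y := by linarith
  have : y ^ 8 = y * y ^ 7 := by ring
  nlinarith

/-- **Eventual form with the constant read off.** From the upper two-step rate with constant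
`K ≥ 0` beyond `N₀`: there is `N₂` with
`|b_n/b_{n−1} − μ| ≤ μ(128μ + 64μK + 64K)/log n` for all `n ≥ N₂`
(`T = ⌊n^{1/8}⌋`, `η = 2K n^{-1/4}`, dropped mass `≤ 32/log n`, `Tη ≤ 16K/log n`, `E_o ≥ 1/μ`).
[cite: MadrasSlade1993, Theorem 7.3.4 (d) (proof, eq. (7.3.14), quantitative form); LawlerSchrammWerner2004SAW, Appendix (A.3)] -/
theorem ratio_rate_eventually_of (hβ1 : 1 ≤ β) {w : ℕ → ℝ} (hw : ∀ n, 0 < w n)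
    (hlam0 : ∀ k, 0 ≤ lam k) (hlam1 : 1 ≤ lam 1) (hsum : ∀ s : Finset ℕ, ∑ k ∈ s, lam k / β ^ k ≤ 1)
    (htail : ∀ m : ℕ, 1 ≤ m → β ≤ m →
      1 - ∑ k ∈ Icc 1 m, lam k / β ^ k ≤ 1 / (1 + Real.log ((m : ℝ) / β) / 2))
    (hren : ∀ n, 1 ≤ n → ∑ k ∈ Icc 1 n, lam k * w (n - k) ≤ w n) {K : ℝ} {N₀ : ℕ} (hK : 0 ≤ K)
    (hU : ∀ N : ℕ, N₀ ≤ N → w (N + 2) / w N ≤ β ^ 2 * (1 + K * (N : ℝ) ^ (-(1 : ℝ) / 4))) :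
    ∃ N₂ : ℕ, ∀ n : ℕ, N₂ ≤ n →
      |w n / w (n - 1) - β| ≤
        β * (128 * β +
          64 * β * K + 64 * K) / Real.log n := by
  set μ := β with hμdef
  have hμ1 : 1 ≤ μ := hβ1
  have hμ : 0 < μ := by linarith
  have hβ0 : 0 < β := hμ
  have hp0 : ∀ k, 0 ≤ mass lam β k := fun k => div_nonneg (hlam0 k) (pow_nonneg hμ.le k)
  have hp1 : μ⁻¹ ≤ mass lam β 1 := by
    show μ⁻¹ ≤ lam 1 / β ^ 1
    rw [pow_one, ← hμdef, ← one_div]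
    exact div_le_div_of_nonneg_right hlam1 hμ.le
  have hsum' : ∀ s : Finset ℕ, ∑ k ∈ s, mass lam β k ≤ 1 := hsum
  -- thresholds: `n^{1/8} ≥ Y₀ := max 2 (max (4K) (μ^2))` and `n ≥ 2 N₀`
  set Y₀ : ℝ := max 2 (max (4 * K) (μ ^ 2)) with hY₀
  have hev1 : ∀ᶠ n : ℕ in atTop, Y₀ ≤ (n : ℝ) ^ ((1 : ℝ) / 8) :=
    ((tendsto_rpow_atTop (by norm_num : (0 : ℝ) < 1 / 8)).comp tendsto_natCast_atTop_atTop).eventually_ge_atTop Y₀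
  have hev2 : ∀ᶠ n : ℕ in atTop, 2 * N₀ ≤ n := eventually_ge_atTop _
  obtain ⟨N₂, hN₂⟩ := eventually_atTop.1 (hev1.and hev2)
  refine ⟨N₂, fun n hn => ?_⟩
  obtain ⟨hy, hN0⟩ := hN₂ n hn
  set y : ℝ := (n : ℝ) ^ ((1 : ℝ) / 8) with hydef
  have hy2 : 2 ≤ y := le_trans (le_max_left _ _) hy
  have hyK : 4 * K ≤ y := le_trans (le_trans (le_max_left _ _) (le_max_right _ _)) hy
  have hyμ : μ ^ 2 ≤ y := le_trans (le_trans (le_max_right _ _) (le_max_right _ _)) hy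
  have hy0 : 0 < y := by linarith
  have hn0' : (0 : ℝ) ≤ n := Nat.cast_nonneg n
  have hn_eq : (n : ℝ) = y ^ 8 := by
    rw [hydef, show ((1 : ℝ) / 8) = ((8 : ℕ) : ℝ)⁻¹ by norm_num, Real.rpow_inv_natCast_pow hn0' (by norm_num)]
  have hn256 : (256 : ℝ) ≤ n := by
    rw [hn_eq]; nlinarith [pow_le_pow_left₀ (by norm_num : (0:ℝ) ≤ 2) hy2 8]
  have hn2 : 2 ≤ n := by exact_mod_cast (show (2 : ℝ) ≤ n by linarith)
  have hn0 : (0 : ℝ) < n := by exact_mod_cast (show 0 < n by omega)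
  have hlogn : 0 < Real.log n := Real.log_pos (by exact_mod_cast (show 1 < n by omega))
  -- `T = ⌊y⌋`
  set T : ℕ := ⌊y⌋₊ with hTdef
  have hT1 : 1 ≤ T := (Nat.one_le_floor_iff y).2 (by linarith)
  have hTy : (T : ℝ) ≤ y := Nat.floor_le hy0.le
  have hyT : y < T + 1 := Nat.lt_floor_add_one y
  have hwinR : (2 * (2 * T + 1) : ℝ) ≤ n := by
    rw [hn_eq]; have := four_mul_add_two_le_pow_eight hy2; linarith
  have hwin : 2 * (2 * T + 1) ≤ n := by exact_mod_cast hwinR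
  have hT : 2 * T + 1 ≤ n := by omega
  -- `η = 2K n^{-1/4} = 2K / y^2`
  set η : ℝ := 2 * K * (n : ℝ) ^ (-(1 : ℝ) / 4) with hηdef
  have hnq : (n : ℝ) ^ (-(1 : ℝ) / 4) = (y ^ 2)⁻¹ := by
    rw [show (-(1 : ℝ) / 4) = ((1 : ℝ) / 8) * (-2) by norm_num, Real.rpow_mul hn0', ← hydef,
      Real.rpow_neg hy0.le, Real.rpow_two]
  have hη0 : 0 ≤ η := by rw [hηdef]; exact mul_nonneg (by linarith) (Real.rpow_nonneg hn0' _)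
  have hηy : η = 2 * K / y ^ 2 := by rw [hηdef, hnq, div_eq_mul_inv]
  have hTη' : (T : ℝ) * η ≤ 2 * K / y := by
    rw [hηy]
    have : (T : ℝ) * (2 * K / y ^ 2) ≤ y * (2 * K / y ^ 2) :=
      mul_le_mul_of_nonneg_right hTy (by positivity)
    calc (T : ℝ) * (2 * K / y ^ 2) ≤ y * (2 * K / y ^ 2) := this
      _ = 2 * K / y := by field_simp
  have hTη : (T : ℝ) * η ≤ 1 / 2 := by
    refine hTη'.trans ?_
    rw [div_le_iff₀ hy0]; linarith
  -- the sandwich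
  have hS := sandwich_packaged_of_le (normSeq β w) ((mass lam β)) n T η hT1 hT hη0 hTη
    (fun k => (normSeq_pos hβ0 hw k).le) hp0 (normSeq_pos hβ0 hw n) (normSeq_pos hβ0 hw (n - 1))
    (lt_of_lt_of_le (inv_pos.2 hμ) hp1) (hsum' _)
    (normSeq_renewal_le hβ0 hren) (hup_of_upperRate hβ0 hw hK hU hwin hN0)
  -- `E_o ≥ 1/μ`
  have hEo : μ⁻¹ ≤ ∑ t ∈ range T, (mass lam β) (2 * t + 1) := by
    have h1 : (mass lam β) (2 * 0 + 1) ≤ ∑ t ∈ range T, (mass lam β) (2 * t + 1) :=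
      Finset.single_le_sum (f := fun t => (mass lam β) (2 * t + 1)) (fun t _ => hp0 _)
        (Finset.mem_range.2 (by omega))
    exact le_trans hp1 (by simpa using h1)
  have hEo_pos : 0 < ∑ t ∈ range T, (mass lam β) (2 * t + 1) := lt_of_lt_of_le (inv_pos.2 hμ) hEo
  -- dropped mass `ε ≤ 32 / log n`
  have h2T1 : 1 ≤ 2 * T := by omega
  have hy2T : y ≤ (2 * T : ℕ) := by push_cast; linarith
  have hμ2T : μ ≤ (2 * T : ℕ) := by nlinarith
  have hε1 := htail (2 * T) h2T1 hμ2T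
  have hL : Real.log n / 16 ≤ Real.log (((2 * T : ℕ) : ℝ) / μ) := by
    have h1 : Real.log (y / μ) ≤ Real.log (((2 * T : ℕ) : ℝ) / μ) :=
      Real.log_le_log (by positivity) (div_le_div_of_nonneg_right hy2T hμ.le)
    have h2 : Real.log (y / μ) = Real.log y - Real.log μ := Real.log_div hy0.ne' hμ.ne'
    have h3 : Real.log y = (1 : ℝ) / 8 * Real.log n := by rw [hydef, Real.log_rpow hn0]
    have h4 : 2 * Real.log μ ≤ Real.log y := by
      have : Real.log (μ ^ 2) = 2 * Real.log μ := by
        rw [Real.log_pow]; norm_num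
      rw [← this]; exact Real.log_le_log (by positivity) hyμ
    linarith
  have hLpos : 0 < Real.log (((2 * T : ℕ) : ℝ) / μ) := lt_of_lt_of_le (by linarith) hL
  have hε : 1 - ∑ k ∈ Icc 1 (2 * T), (mass lam β) k ≤ 32 / Real.log n := by
    change 1 - ∑ k ∈ Icc 1 (2 * T), lam k / β ^ k ≤ 32 / Real.log n
    refine hε1.trans ?_
    calc 1 / (1 + Real.log (((2 * T : ℕ) : ℝ) / μ) / 2)
        ≤ 1 / (Real.log (((2 * T : ℕ) : ℝ) / μ) / 2) :=
          one_div_le_one_div_of_le (by linarith) (by linarith)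
      _ ≤ 1 / (Real.log n / 32) := one_div_le_one_div_of_le (by positivity) (by linarith)
      _ = 32 / Real.log n := by rw [one_div_div]
  -- `Tη ≤ 16K / log n` via `log n ≤ 8 y`
  have hlog8 : Real.log n ≤ 8 * y := by
    have := Real.log_le_rpow_div hn0' (by norm_num : (0 : ℝ) < 1 / 8)
    rw [← hydef] at this; linarith
  have hTηlog : (T : ℝ) * η ≤ 16 * K / Real.log n := by
    refine hTη'.trans ?_
    rw [div_le_div_iff₀ hy0 hlogn]
    nlinarith
  -- assemble `|a_n/a_{n-1} − 1| ≤ K₁ / log n`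
  have hfrac : ((1 - ∑ k ∈ Icc 1 (2 * T), (mass lam β) k) + T * η) / (∑ t ∈ range T, (mass lam β) (2 * t + 1)) ≤
      μ * ((32 + 16 * K) / Real.log n) := by
    have hnum0 : 0 ≤ (1 - ∑ k ∈ Icc 1 (2 * T), (mass lam β) k) + T * η := by
      have := hsum' (Icc 1 (2 * T))
      have := mul_nonneg (Nat.cast_nonneg T) hη0
      linarith
    calc ((1 - ∑ k ∈ Icc 1 (2 * T), (mass lam β) k) + T * η) / (∑ t ∈ range T, (mass lam β) (2 * t + 1))
        ≤ ((1 - ∑ k ∈ Icc 1 (2 * T), (mass lam β) k) + T * η) / μ⁻¹ :=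
          div_le_div_of_nonneg_left hnum0 (inv_pos.2 hμ) hEo
      _ = μ * ((1 - ∑ k ∈ Icc 1 (2 * T), (mass lam β) k) + T * η) := by rw [div_inv_eq_mul, mul_comm]
      _ ≤ μ * (32 / Real.log n + 16 * K / Real.log n) := by gcongr
      _ = μ * ((32 + 16 * K) / Real.log n) := by ring
  have hA : |normSeq β w n / normSeq β w (n - 1) - 1| ≤
      (128 * μ + 64 * μ * K + 64 * K) / Real.log n := by
    refine hS.trans ?_
    have : 4 * (μ * ((32 + 16 * K) / Real.log n) + 16 * K / Real.log n) =
        (128 * μ + 64 * μ * K + 64 * K) / Real.log n := by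
      field_simp; ring
    rw [← this]; gcongr
  -- convert to `b_n / b_{n-1}`
  have hconv : w n / w (n - 1) - μ =
      μ * (normSeq β w n / normSeq β w (n - 1) - 1) := by
    have hb1 : (0 : ℝ) < w (n - 1) := hw (n - 1)
    obtain ⟨n', hn'⟩ : ∃ n', n = n' + 1 := ⟨n - 1, by omega⟩
    subst hn'
    have hb0 : (0 : ℝ) < w n' := hw n'
    have haB : normSeq β w (n' + 1) / normSeq β w (n' + 1 - 1) =
        w (n' + 1) / (μ * w n') := by
      simp only [normSeq, Nat.add_sub_cancel]
      rw [← hμdef, pow_succ]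
      field_simp
    rw [haB, Nat.add_sub_cancel]
    field_simp
  rw [hconv, abs_mul, abs_of_pos hμ, mul_div_assoc]
  exact mul_le_mul_of_nonneg_left hA hμ.le

/-- **The one-step rate from the two inputs**: an upper two-step rate `b_{N+2}/b_N ≤ μ²(1 + K' N^{-1/4})`
(`N ≥ N₀`) implies a RATE for Madras–Slade Thm 7.3.4(d): `∃ K, ∀ N ≥ 2, |b_{N+1}/b_N − μ| ≤ K/log N`
(every `d ≥ 2`; the finitely many `N` below the threshold are absorbed into `K`).
[cite: MadrasSlade1993, Theorem 7.3.4 (d) (quantitative form); LawlerSchrammWerner2004SAW, Appendix (A.3)] -/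
theorem ratio_rate_log_of (hβ1 : 1 ≤ β) {w : ℕ → ℝ} (hw : ∀ n, 0 < w n)
    (hlam0 : ∀ k, 0 ≤ lam k) (hlam1 : 1 ≤ lam 1) (hsum : ∀ s : Finset ℕ, ∑ k ∈ s, lam k / β ^ k ≤ 1)
    (htail : ∀ m : ℕ, 1 ≤ m → β ≤ m →
      1 - ∑ k ∈ Icc 1 m, lam k / β ^ k ≤ 1 / (1 + Real.log ((m : ℝ) / β) / 2))
    (hren : ∀ n, 1 ≤ n → ∑ k ∈ Icc 1 n, lam k * w (n - k) ≤ w n)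
    (hU : ∃ K' : ℝ, ∃ N₀ : ℕ, ∀ N : ℕ, N₀ ≤ N → w (N + 2) / w N ≤
      β ^ 2 * (1 + K' * (N : ℝ) ^ (-(1 : ℝ) / 4))) :
    ∃ K : ℝ, ∀ N : ℕ, 2 ≤ N →
      |w (N + 1) / w N - β| ≤
        K / Real.log N := by
  obtain ⟨K', N₀, hU⟩ := hU
  set μ := β with hμdef
  have hμ : 0 < μ := by simp only [hμdef]; linarith
  have hU' : ∀ N : ℕ, N₀ ≤ N → w (N + 2) / w N ≤ μ ^ 2 * (1 + max K' 0 * (N : ℝ) ^ (-(1 : ℝ) / 4)) := by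
    intro N hN
    refine (hU N hN).trans ?_
    have hr : 0 ≤ (N : ℝ) ^ (-(1 : ℝ) / 4) := Real.rpow_nonneg (Nat.cast_nonneg N) _
    have hμ2 : 0 ≤ μ ^ 2 := sq_nonneg _
    have : K' * (N : ℝ) ^ (-(1 : ℝ) / 4) ≤ max K' 0 * (N : ℝ) ^ (-(1 : ℝ) / 4) :=
      mul_le_mul_of_nonneg_right (le_max_left _ _) hr
    nlinarith
  have hK0 : 0 ≤ max K' 0 := le_max_right _ _
  obtain ⟨N₂, hN₂⟩ := ratio_rate_eventually_of hβ1 hw hlam0 hlam1 hsum htail hren hK0 hU'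
  set K₁ : ℝ := μ * (128 * μ + 64 * μ * max K' 0 + 64 * max K' 0) with hK₁
  have hK₁0 : 0 ≤ K₁ := by positivity
  -- the finite patch
  set g : ℕ → ℝ := fun N =>
    |w (N + 1) / w N - μ| * Real.log N with hg
  have hg0 : ∀ N, 0 ≤ g N := fun N =>
    mul_nonneg (abs_nonneg _) (Real.log_natCast_nonneg N)
  set S : ℝ := ∑ N ∈ range N₂, g N with hS
  have hS0 : 0 ≤ S := Finset.sum_nonneg fun N _ => hg0 N
  refine ⟨K₁ + S, fun N hN => ?_⟩
  have hlogN : 0 < Real.log N := Real.log_pos (by exact_mod_cast (show 1 < N by omega))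
  by_cases hcase : N₂ ≤ N + 1
  · -- asymptotic regime
    have h := hN₂ (N + 1) hcase
    rw [Nat.add_sub_cancel] at h
    have hlog_le : Real.log N ≤ Real.log ((N + 1 : ℕ) : ℝ) :=
      Real.log_le_log (by exact_mod_cast (show 0 < N by omega)) (by exact_mod_cast (show N ≤ N + 1 by omega))
    calc |w (N + 1) / w N - μ|
        ≤ K₁ / Real.log ((N + 1 : ℕ) : ℝ) := h
      _ ≤ K₁ / Real.log N := div_le_div_of_nonneg_left hK₁0 hlogN hlog_le
      _ ≤ (K₁ + S) / Real.log N := by gcongr; linarith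
  · -- finite regime: `N < N₂`
    have hmem : N ∈ range N₂ := Finset.mem_range.2 (by omega)
    have hle : g N ≤ S := Finset.single_le_sum (fun M _ => hg0 M) hmem
    have h1 : |w (N + 1) / w N - μ| ≤ S / Real.log N := by
      rw [le_div_iff₀ hlogN]; exact hle
    calc |w (N + 1) / w N - μ|
        ≤ S / Real.log N := h1
      _ ≤ (K₁ + S) / Real.log N := by gcongr; linarith


end Literature.Probability.Process.Renewal.LogRate
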